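import Mathlib.AlgebraicTopology.FundamentalGroupoid.SimplyConnected
import Mathlib.Analysis.InnerProductSpace.PiL2
import HarnessLib

/-!
# Named fact: `S⁴` is simply connected (and hence so is anything homotopy equivalent to it)

Grounder file (D-0014 named facts) for the route `SmoothPoincare4/PIC` (assembly items
stmt-SmoothPoincare4-0474 / -0477 take the derived statement
`Literature.simplyConnectedSpace_of_homotopyEquiv_sphere_four_of` verbatim as their hypothesis `hSC`).

`Sⁿ` is simply connected for `n ≥ 2` (Hatcher, *Algebraic Topology*, Prop. 1.14). Mathlib does
not yet have `π₁(Sⁿ) = 1` (no `SimplyConnectedSpace (Metric.sphere …)` instance; `exact?` fails),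
so this is recorded as the NAMED FACT `Literature.Topology.FourManifolds.simplyConnectedSpace_sphere_four`. Homotopy invariance
of simple connectivity IS in Mathlib (`ContinuousMap.HomotopyEquiv.simplyConnectedSpace`,
Hatcher Prop. 1.18), so the form used by the route — every space homotopy equivalent to `S⁴` is
simply connected — is a one-line THEOREM from the fact, not a second assumption.

Nothing is asserted by the `def`; users take `(h : Literature.simplyConnectedSpace_sphere_four)`.

## References

* A. Hatcher, *Algebraic Topology*, CUP 2002, Prop. 1.14 (`π₁(Sⁿ) = 0`, `n ≥ 2`), Prop. 1.18.
-/

noncomputable section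

open ContinuousMap

namespace Literature.Topology.FourManifolds

/-- NAMED FACT (Hatcher 2002, Prop. 1.14: `π₁(Sⁿ) = 0` for `n ≥ 2`, here `n = 4`). The standard
sphere `S⁴ ⊂ ℝ⁵` is simply connected (path connected with trivial fundamental group, Mathlib
`SimplyConnectedSpace`). Users take `(h : simplyConnectedSpace_sphere_four)`.
[cite: HatcherAT2002, Prop. 1.14] -/
def simplyConnectedSpace_sphere_four : Prop :=
  SimplyConnectedSpace (Metric.sphere (0 : EuclideanSpace ℝ (Fin 5)) 1)

/-- Every topological space homotopy equivalent to `S⁴` is simply connected, GIVEN the named fact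
`simplyConnectedSpace_sphere_four`; the transport along the homotopy equivalence is Mathlib's
`ContinuousMap.HomotopyEquiv.simplyConnectedSpace` (Hatcher Prop. 1.18). This is the verbatim
hypothesis `hSC` of route items stmt-SmoothPoincare4-0474/0477. [folklore] -/
theorem simplyConnectedSpace_of_homotopyEquiv_sphere_four
    (h : simplyConnectedSpace_sphere_four) :
    ∀ (M : Type) [TopologicalSpace M],
      M ≃ₕ Metric.sphere (0 : EuclideanSpace ℝ (Fin 5)) 1 → SimplyConnectedSpace M := by
  intro M _ e
  haveI : SimplyConnectedSpace (Metric.sphere (0 : EuclideanSpace ℝ (Fin 5)) 1) := h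
  exact e.simplyConnectedSpace

end Literature.Topology.FourManifolds

end
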